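import Mathlib
import Summits.NavierStokesRegularity.NavierStokesRegularity.Theorems.PowerGaugeEulerLiouville.Negative.FatVorticityFiniteVolume
import Summits.NavierStokesRegularity.NavierStokesRegularity.Theorems.PowerGaugeEulerLiouville.Negative.ForwardRelaxingClassicalFlow
import Summits.NavierStokesRegularity.NavierStokesRegularity.Theorems.EulerZoomLiouvillePowerGaugeEulerLiouvilleDSSFiniteEnergy

/-!
# Crux `EulerZoomLiouville.PowerGaugeEulerLiouville` (stmt-NavierStokesRegularity-19832) — forward energy conservation and
# «NO CLASSICAL EULER FLOW WITH THIN VORTICITY IS RELAXING» (energy floor discharged)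

Negative-lane structure record (prover hand leafhand-ns-eulerzoomliouville-8 g0; `--supports` stmt-19832).  The fat-vorticity
law (`…Negative.FatVorticityFiniteVolume.no_thinVorticity_relaxingFlow'`) assumed an ENERGY FLOOR.  For classical Euler
flows the floor is energy conservation, which the crux lineage proved on the ancient slab
(`FiniteEnergy.integral_norm_sq_eq_of_classical_euler`, `(−∞,0)`); by the kernel time reversal of
`…Negative.ForwardRelaxingClassicalFlow` it transfers to `(0,∞)`:

* `integral_norm_sq_eq_of_classical_euler_forward` — a classical Euler flow `(v,q)` on `(0,∞) × ℝ³` with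
  `∫|v|², ∫|v|³, ∫|q||v|` bounded on `[s,t] ⊂ (0,∞)` has `∫|v(t)|² = ∫|v(s)|²`;
* `no_thinVorticity_relaxingEulerFlow` — consequently a classical Euler flow on `(0,∞) × ℝ³` with these slice budgets
  locally uniformly in time, positive energy at one time, finite-enstrophy slices and vortex VOLUME `vol(supp curl v(s)) ≤ V₀ < ∞`
  has infinite space–time enstrophy `∫∫_{(0,∞)×ℝ³}|∇v|²_F`: it is NOT in the forward refutation door (F) of X_E.

So every classical candidate for door (F) spreads its vorticity over unbounded volume.  WHAT THIS IS NOT: not a refutation or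
proof of the crux, of a stub, or of the route; not a claim about Navier–Stokes. [folklore] -/

noncomputable section
set_option linter.dupNamespace false
namespace Summit.NavierStokesRegularity.NavierStokesRegularity.Theorems.PowerGaugeEulerLiouville.Negative

open MeasureTheory Set Function Filter Topology Metric Literature.Analysis Literature.Analysis.FluidPDE
open scoped NNReal ENNReal

/-- **Energy conservation for classical Euler flows on `(0,∞)`** (time-reversed from the ancient-slab version of the crux
lineage): for `0 < s < t` with `∫|v(τ)|², ∫|v(τ)|³, ∫|q(τ)||v(τ)| ≤ M` (integrable) on `[s,t]`, `∫|v(t)|² = ∫|v(s)|²`. [folklore] -/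
theorem integral_norm_sq_eq_of_classical_euler_forward
    {v : ℝ → EuclideanSpace ℝ (Fin 3) → EuclideanSpace ℝ (Fin 3)} {q : ℝ → EuclideanSpace ℝ (Fin 3) → ℝ}
    (hsol : IsClassicalEulerSolutionOn (Ioi (0 : ℝ)) 0 v q) {s t : ℝ} (hs : 0 < s) (hst : s < t) {M : ℝ}
    (hE : ∀ τ ∈ Icc s t, Integrable (fun y => ‖v τ y‖ ^ 2) ∧ ∫ y, ‖v τ y‖ ^ 2 ≤ M)
    (h3 : ∀ τ ∈ Icc s t, Integrable (fun y => ‖v τ y‖ ^ 3) ∧ ∫ y, ‖v τ y‖ ^ 3 ≤ M)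
    (hP : ∀ τ ∈ Icc s t, Integrable (fun y => |q τ y| * ‖v τ y‖) ∧ ∫ y, |q τ y| * ‖v τ y‖ ≤ M) :
    ∫ y, ‖v t y‖ ^ 2 = ∫ y, ‖v s y‖ ^ 2 := by
  have hsol' := isClassicalEulerSolutionOn_timeReversal hsol
  have hmem : ∀ τ ∈ Icc (-t) (-s), -τ ∈ Icc s t := fun τ hτ => ⟨by linarith [hτ.2], by linarith [hτ.1]⟩
  have h := FiniteEnergy.integral_norm_sq_eq_of_classical_euler (u := fun τ x => -v (-τ) x)
    (p := fun τ x => q (-τ) x) hsol' (s := -t) (t := -s) (by linarith) (by linarith) (M := M)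
    (fun τ hτ => by simpa only [norm_neg] using hE (-τ) (hmem τ hτ))
    (fun τ hτ => by simpa only [norm_neg] using h3 (-τ) (hmem τ hτ))
    (fun τ hτ => by simpa only [norm_neg] using hP (-τ) (hmem τ hτ))
  simp only [norm_neg, neg_neg] at h
  exact h.symm

/-- For an integrable `‖f‖²`: `∫⁻ ‖f‖ₑ² = ofReal (∫ ‖f‖²)` (finite). [folklore] -/
theorem lintegral_enorm_sq_eq_ofReal_integral {f : EuclideanSpace ℝ (Fin 3) → EuclideanSpace ℝ (Fin 3)}
    (hf : Integrable (fun y => ‖f y‖ ^ 2)) :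
    ∫⁻ y, ‖f y‖ₑ ^ 2 = ENNReal.ofReal (∫ y, ‖f y‖ ^ 2) := by
  rw [ofReal_integral_eq_lintegral_ofReal hf (Eventually.of_forall fun y => sq_nonneg _)]
  refine lintegral_congr fun y => ?_
  rw [← ofReal_norm, ENNReal.ofReal_pow (norm_nonneg _)]

/-- **NO CLASSICAL EULER FLOW WITH THIN VORTICITY IS RELAXING.**  Let `(v,q)` be a classical Euler flow on `(0,∞) × ℝ³`
whose slices have `∫|v|², ∫|v|³, ∫|q||v|` bounded locally uniformly in time (so that energy is conserved), with positive
energy at some time `s₀ > 0`, finite-enstrophy slices, and vortex volume `vol(supp curl v(s)) ≤ V₀ < ∞` for all `s > 0`.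
Then `∫∫_{(0,∞)×ℝ³}|∇v|²_F ≤ M` is impossible: the flow is not a relaxing flow of door (F). [folklore] -/
theorem no_thinVorticity_relaxingEulerFlow
    {v : ℝ → EuclideanSpace ℝ (Fin 3) → EuclideanSpace ℝ (Fin 3)} {q : ℝ → EuclideanSpace ℝ (Fin 3) → ℝ} {M : ℝ≥0}
    (hsol : IsClassicalEulerSolutionOn (Ioi (0 : ℝ)) 0 v q)
    (hunif : ∀ a b : ℝ, 0 < a → a < b → ∃ M' : ℝ, ∀ τ ∈ Icc a b,
      (Integrable (fun y => ‖v τ y‖ ^ 2) ∧ ∫ y, ‖v τ y‖ ^ 2 ≤ M') ∧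
      (Integrable (fun y => ‖v τ y‖ ^ 3) ∧ ∫ y, ‖v τ y‖ ^ 3 ≤ M') ∧
      (Integrable (fun y => |q τ y| * ‖v τ y‖) ∧ ∫ y, |q τ y| * ‖v τ y‖ ≤ M'))
    {s₀ : ℝ} (hs₀ : 0 < s₀) (hpos : 0 < ∫ y, ‖v s₀ y‖ ^ 2)
    (hωfin : ∀ s : ℝ, 0 < s → ∫⁻ x, ‖curl (v s) x‖ₑ ^ 2 < ⊤)
    {V₀ : ℝ≥0∞} (hV₀ : V₀ ≠ ⊤) (hvol : ∀ s : ℝ, 0 < s → volume (Function.support (curl (v s))) ≤ V₀)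
    (hEns : ∫⁻ z in Ioi (0 : ℝ) ×ˢ (univ : Set (EuclideanSpace ℝ (Fin 3))),
      ENNReal.ofReal (frobeniusNormSq (fderiv ℝ (v z.1) z.2)) ≤ (M : ℝ≥0∞)) : False := by
  -- every slice is integrable in energy and the energy is constant `= ∫|v(s₀)|²`
  have hint : ∀ s : ℝ, 0 < s → Integrable (fun y => ‖v s y‖ ^ 2) := by
    intro s hs
    obtain ⟨M', hM'⟩ := hunif s (s + 1) hs (by linarith)
    exact (hM' s ⟨le_rfl, by linarith⟩).1.1
  have hcons : ∀ s : ℝ, 0 < s → ∫ y, ‖v s y‖ ^ 2 = ∫ y, ‖v s₀ y‖ ^ 2 := by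
    intro s hs
    rcases lt_trichotomy s s₀ with h | h | h
    · obtain ⟨M', hM'⟩ := hunif s s₀ hs h
      exact (integral_norm_sq_eq_of_classical_euler_forward hsol hs h (fun τ hτ => (hM' τ hτ).1)
        (fun τ hτ => (hM' τ hτ).2.1) (fun τ hτ => (hM' τ hτ).2.2)).symm
    · rw [h]
    · obtain ⟨M', hM'⟩ := hunif s₀ s hs₀ h
      exact integral_norm_sq_eq_of_classical_euler_forward hsol hs₀ h (fun τ hτ => (hM' τ hτ).1)
        (fun τ hτ => (hM' τ hτ).2.1) (fun τ hτ => (hM' τ hτ).2.2)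
  -- hypotheses of the fat-vorticity law
  have hvInf : ContDiffOn ℝ (⊤ : ℕ∞) (uncurry v) (Ioi (0 : ℝ) ×ˢ (univ : Set (EuclideanSpace ℝ (Fin 3)))) :=
    hsol.smooth_velocity
  have hv : ContDiffOn ℝ 1 (uncurry v) (Ioi (0 : ℝ) ×ˢ (univ : Set (EuclideanSpace ℝ (Fin 3)))) :=
    hvInf.of_le (by norm_cast)
  have hC2 : ∀ s : ℝ, 0 < s → ContDiff ℝ 2 (v s) := fun s hs =>
    (hsol.contDiff_velocity (show s ∈ Ioi (0 : ℝ) from hs)).of_le (by norm_cast)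
  have hdiv : ∀ s : ℝ, 0 < s → VectorCalculus.IsDivFree (v s) := fun s hs => hsol.divFree s hs
  have hfin : ∀ s : ℝ, 0 < s → ∫⁻ x, ‖v s x‖ₑ ^ 2 < ⊤ := by
    intro s hs
    rw [lintegral_enorm_sq_eq_ofReal_integral (hint s hs)]
    exact ENNReal.ofReal_lt_top
  set E₀ : ℝ≥0∞ := ENNReal.ofReal (∫ y, ‖v s₀ y‖ ^ 2) with hE₀def
  have hE₀ : E₀ ≠ 0 := (ENNReal.ofReal_pos.2 hpos).ne'
  have hfloor : ∀ s : ℝ, 0 < s → E₀ ≤ ∫⁻ x, ‖v s x‖ₑ ^ 2 := by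
    intro s hs
    rw [lintegral_enorm_sq_eq_ofReal_integral (hint s hs), hcons s hs]
  exact no_thinVorticity_relaxingFlow' hv hC2 hdiv hfin hωfin hE₀ hV₀ hfloor hvol hEns

end Summit.NavierStokesRegularity.NavierStokesRegularity.Theorems.PowerGaugeEulerLiouville.Negative
end
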